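import Literature.Topology.FourManifolds.FibrewiseCriticalSection
import Literature.Topology.FourManifolds.FibrewiseMorseChart
import HarnessLib

/-!
# The fibrewise critical section and the fibrewise Morse lemma over a general parameter space

Topic `Literature/Topology/FourManifolds`.  `FibrewiseCriticalSection.lean` and
`FibrewiseMorseChart.lean` run the parametric Morse lemma (Hirsch, *Differential Topology*, Ch. 6
§1, proof of Thm. 1.1, with a parameter) for families `f : ℝ × ℝᵏ → ℝ` over a ONE-dimensional
parameter — enough for the fold (parameter `t`, `k = 3` fibre variables).  The splitting lemma
at a CUSP of a map `ℝ⁴ → ℝ²` (Golubitsky–Guillemin VI §2 / the reduction of the Morin normal form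
`(t, x³ + tx ± y² ± z²)` to the plane) needs the same two statements over the two-dimensional
parameter `(t, x)`: the fibre Hessian in the two remaining fibre variables `(y, z)` is
nondegenerate, `x` being the radical direction.  This file redoes both statements for a family
`f : P × ℝᵏ → ℝ` over an arbitrary finite-dimensional real normed space `P`; the proofs are
those of the one-parameter files verbatim (inverse function theorem for
`(p, w) ↦ (p, ∇f(p, w))`; fibre Hadamard form `B(p, u)` of
`Literature.Analysis.Calculus.fibreHadamardSnd` — already stated over a general parameter —
Hirsch's lemma `P(B)` and sorted Sylvester coordinates).

* `Splitting.fibreGrad`, `Splitting.fibreHessian` (+ API) — the fibre gradient / Hessian of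
  `f : P × ℝᵏ → ℝ`;
* `Splitting.exists_fibrewiseCriticalSection` — **the `C^∞` critical section `ξ : U → ℝᵏ`,
  `U ∋ p₀` open in `P`**, when `∇f(p₀, w₀) = 0` and the fibre Hessian there is nondegenerate;
* `Splitting.exists_fibrewiseMorseCoords` — **fibrewise Morse coordinates `y(p, u)`** for a
  family with critical zero section and nondegenerate fibre Hessian at `(p₀, 0)`:
  `g(p, u) = -(y₀² + ⋯ + y_{σ-1}²) + (y_σ² + ⋯)`.

Everything is PROVED; no named fact (D-0026).

## References

* M. W. Hirsch, *Differential Topology*, GTM 33 (1976), Ch. 6 §1, Thm. 1.1 and Lemma p. 145.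
  [HirschDT1976]
* M. Golubitsky, V. Guillemin, *Stable Mappings and Their Singularities* (1973), Ch. VI §2
  (reduction to the plane at a cusp). [GolubitskyGuillemin1973]
-/

noncomputable section

set_option maxSynthPendingDepth 2

open Set Function Filter Module
open scoped Topology ContDiff

namespace Literature.Topology.FourManifolds

namespace Splitting

/-- Local notation: `𝔼 n` is the model Euclidean space `EuclideanSpace ℝ (Fin n)`. -/
local notation "𝔼 " n:arg => EuclideanSpace ℝ (Fin n)

variable {P : Type*} [NormedAddCommGroup P] [NormedSpace ℝ P] {k : ℕ}

/-! ### Linear algebra on `P × ℝᵏ` -/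

/-- `(0, b) = Σᵢ bᵢ • (0, eᵢ)` in `P × ℝᵏ`. [folklore] -/
theorem inr_eq_sum_smul_single (b : 𝔼 k) :
    (((0 : P), b) : P × 𝔼 k) =
      ∑ i : Fin k, b i • (((0 : P), EuclideanSpace.single i (1 : ℝ)) : P × 𝔼 k) := by
  have hb : b = ∑ i : Fin k, b i • EuclideanSpace.single i (1 : ℝ) := by
    conv_lhs => rw [← (EuclideanSpace.basisFun (Fin k) ℝ).sum_repr b]
    simp
  refine Prod.ext ?_ ?_
  · simp [Prod.fst_sum]
  · rw [Prod.snd_sum]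
    simpa using hb

/-- `L (0, b) = Σᵢ bᵢ L (0, eᵢ)` for a continuous linear `L` on `P × ℝᵏ`. [folklore] -/
theorem apply_inr_eq_sum {F : Type*} [NormedAddCommGroup F] [NormedSpace ℝ F]
    (L : (P × 𝔼 k) →L[ℝ] F) (b : 𝔼 k) :
    L ((0 : P), b) = ∑ i : Fin k, b i • L ((0 : P), EuclideanSpace.single i (1 : ℝ)) := by
  rw [inr_eq_sum_smul_single b, map_sum]
  exact Finset.sum_congr rfl fun i _ => by rw [map_smul]

/-! ### The fibre gradient and the fibre Hessian -/

/-- **The fibre gradient** of `f : P × ℝᵏ → ℝ` at `x = (p, w)`: `(Df(x)(0, eᵢ))ᵢ`. [folklore] -/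
def fibreGrad (f : P × 𝔼 k → ℝ) (x : P × 𝔼 k) : 𝔼 k :=
  WithLp.toLp 2 fun i => fderiv ℝ f x ((0 : P), EuclideanSpace.single i (1 : ℝ))

/-- Components of the fibre gradient. [folklore] -/
@[simp] theorem fibreGrad_apply (f : P × 𝔼 k → ℝ) (x : P × 𝔼 k) (i : Fin k) :
    fibreGrad f x i = fderiv ℝ f x ((0 : P), EuclideanSpace.single i (1 : ℝ)) := rfl

/-- `∇f(x) = 0 ↔ Df(x)(0, ·) = 0`. [folklore] -/
theorem fibreGrad_eq_zero_iff (f : P × 𝔼 k → ℝ) (x : P × 𝔼 k) :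
    fibreGrad f x = 0 ↔ ∀ a : 𝔼 k, fderiv ℝ f x ((0 : P), a) = 0 := by
  constructor
  · intro h a
    rw [apply_inr_eq_sum]
    refine Finset.sum_eq_zero fun i _ => ?_
    have hi : fibreGrad f x i = 0 := by rw [h]; rfl
    rw [fibreGrad_apply] at hi
    rw [hi, smul_zero]
  · intro h
    ext i
    simpa using h (EuclideanSpace.single i (1 : ℝ))

/-- The fibre gradient of a `C^∞` family is `C^∞`. [folklore] -/
theorem contDiff_fibreGrad {f : P × 𝔼 k → ℝ} (hf : ContDiff ℝ ∞ f) :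
    ContDiff ℝ ∞ (fibreGrad f) := by
  rw [contDiff_euclidean]
  intro i
  simpa using (hf.fderiv_right le_rfl).clm_apply contDiff_const

/-- `D(∂f/∂wᵢ)(x) v = D²f(x) v (0, eᵢ)`. [folklore] -/
theorem hasFDerivAt_fibreGrad_apply {f : P × 𝔼 k → ℝ} (hf : ContDiff ℝ ∞ f) (x : P × 𝔼 k)
    (i : Fin k) :
    HasFDerivAt (fun x => fibreGrad f x i)
      ((fderiv ℝ (fderiv ℝ f) x).flip ((0 : P), EuclideanSpace.single i (1 : ℝ))) x := by
  have hD2 : HasFDerivAt (fderiv ℝ f) (fderiv ℝ (fderiv ℝ f) x) x :=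
    (((hf.fderiv_right (m := ∞) le_rfl).differentiable (by simp)) x).hasFDerivAt
  have h := hD2.clm_apply (hasFDerivAt_const (((0 : P), EuclideanSpace.single i (1 : ℝ)) :
    P × 𝔼 k) x)
  simp only [fibreGrad_apply]
  refine h.congr_fderiv (ContinuousLinearMap.ext fun v => ?_)
  simp

/-- **The fibre Hessian** of `g : P × ℝᵏ → ℝ` at `x`: `(a, b) ↦ D²g(x)(0, a)(0, b)`.
[folklore] -/
def fibreHessian (g : P × 𝔼 k → ℝ) (x : P × 𝔼 k) : 𝔼 k →L[ℝ] 𝔼 k →L[ℝ] ℝ :=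
  (fderiv ℝ (fderiv ℝ g) x).bilinearComp (ContinuousLinearMap.inr ℝ P (𝔼 k))
    (ContinuousLinearMap.inr ℝ P (𝔼 k))

/-- `fibreHessian g x a b = D²g(x)(0, a)(0, b)`. [folklore] -/
@[simp] theorem fibreHessian_apply (g : P × 𝔼 k → ℝ) (x : P × 𝔼 k) (a b : 𝔼 k) :
    fibreHessian g x a b = fderiv ℝ (fderiv ℝ g) x ((0 : P), a) ((0 : P), b) := by
  simp [fibreHessian]

/-! ### The critical section -/

variable [FiniteDimensional ℝ P]

/-- **The critical section of a family with nondegenerate fibre Hessian, over a parameter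
space `P`** (inverse function theorem for `(p, w) ↦ (p, ∇f(p, w))`, whose derivative
`(π, a) ↦ (π, ∂ₚ∇f π + Hess a)` is injective): `C^∞` `f : P × ℝᵏ → ℝ`, `∇f(p₀, w₀) = 0` and
nondegenerate fibre Hessian at `(p₀, w₀)` give an open `U ∋ p₀` and a `C^∞` map `ξ : U → ℝᵏ`
with `ξ p₀ = w₀` and `∇f(p, ξ p) = 0`. [cite: HirschDT1976, Ch. 6 §1] -/
theorem exists_fibrewiseCriticalSection {f : P × 𝔼 k → ℝ} (hf : ContDiff ℝ ∞ f) {p₀ : P}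
    {w₀ : 𝔼 k} (hcrit : fibreGrad f (p₀, w₀) = 0)
    (hH : ∀ a : 𝔼 k, (∀ b : 𝔼 k,
      fderiv ℝ (fderiv ℝ f) (p₀, w₀) ((0 : P), a) ((0 : P), b) = 0) → a = 0) :
    ∃ U : Set P, IsOpen U ∧ p₀ ∈ U ∧ ∃ ξ : P → 𝔼 k, ContDiffOn ℝ ∞ ξ U ∧ ξ p₀ = w₀ ∧
      ∀ p ∈ U, fibreGrad f (p, ξ p) = 0 := by
  have hG : ContDiff ℝ ∞ (fibreGrad f) := contDiff_fibreGrad hf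
  set Θ : P × 𝔼 k → P × 𝔼 k := fun q => (q.1, fibreGrad f q) with hΘ_def
  have hΘs : ContDiff ℝ ∞ Θ := contDiff_fst.prodMk hG
  have hGd : HasFDerivAt (fibreGrad f) (fderiv ℝ (fibreGrad f) (p₀, w₀)) (p₀, w₀) :=
    ((hG.differentiable (by simp)) _).hasFDerivAt
  set Θ' : (P × 𝔼 k) →L[ℝ] P × 𝔼 k :=
    (ContinuousLinearMap.fst ℝ P (𝔼 k)).prod (fderiv ℝ (fibreGrad f) (p₀, w₀)) with hΘ'
  have hΘd : HasFDerivAt Θ Θ' (p₀, w₀) := hasFDerivAt_fst.prodMk hGd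
  have hcomp : ∀ (v : P × 𝔼 k) (i : Fin k), fderiv ℝ (fibreGrad f) (p₀, w₀) v i =
      fderiv ℝ (fderiv ℝ f) (p₀, w₀) v ((0 : P), EuclideanSpace.single i (1 : ℝ)) := by
    intro v i
    have h1 : fderiv ℝ (fun x => fibreGrad f x i) (p₀, w₀) =
        (EuclideanSpace.proj i : 𝔼 k →L[ℝ] ℝ).comp (fderiv ℝ (fibreGrad f) (p₀, w₀)) :=
      ((EuclideanSpace.proj i : 𝔼 k →L[ℝ] ℝ).hasFDerivAt.comp _ hGd).fderiv
    have h2 := (hasFDerivAt_fibreGrad_apply hf (p₀, w₀) i).fderiv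
    have h3 := congrArg (fun L : (P × 𝔼 k) →L[ℝ] ℝ => L v) (h1.symm.trans h2)
    simpa using h3
  have hinj : Injective Θ' := by
    refine (injective_iff_map_eq_zero Θ').2 fun v hv => ?_
    obtain ⟨π, a⟩ := v
    have h1 : π = 0 := by simpa [hΘ'] using congrArg Prod.fst hv
    subst h1
    have h2 : fderiv ℝ (fibreGrad f) (p₀, w₀) ((0 : P), a) = 0 := by
      simpa [hΘ'] using congrArg Prod.snd hv
    have ha : a = 0 := by
      refine hH a fun b => ?_
      rw [apply_inr_eq_sum (fderiv ℝ (fderiv ℝ f) (p₀, w₀) ((0 : P), a)) b]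
      refine Finset.sum_eq_zero fun i _ => ?_
      rw [← hcomp ((0 : P), a) i, h2]
      simp
    rw [ha]
    rfl
  obtain ⟨T, hT⟩ := exists_continuousLinearEquiv_coe_eq hinj
  obtain ⟨G₁, hG₁Θ, hmem, -, -, hG₁s'⟩ :=
    exists_openPartialHomeomorph_contDiffOn_symm isOpen_univ (mem_univ (p₀, w₀)) (m := ∞)
      (by simp) hΘs.contDiffOn T (by rw [hT]; exact hΘd)
  have hΘ₀ : G₁ (p₀, w₀) = (p₀, 0) := by
    rw [hG₁Θ]
    simp [hΘ_def, hcrit]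
  have htarget : ((p₀, (0 : 𝔼 k)) : P × 𝔼 k) ∈ G₁.target := hΘ₀ ▸ G₁.map_source hmem
  refine ⟨{p | ((p, (0 : 𝔼 k)) : P × 𝔼 k) ∈ G₁.target},
    G₁.open_target.preimage (continuous_id.prodMk continuous_const), htarget,
    fun p => (G₁.symm (p, 0)).2, ?_, ?_, ?_⟩
  · have hc : ContDiffOn ℝ ∞ (fun p : P => ((p, (0 : 𝔼 k)) : P × 𝔼 k))
        {p | ((p, (0 : 𝔼 k)) : P × 𝔼 k) ∈ G₁.target} :=
      (contDiff_id.prodMk contDiff_const).contDiffOn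
    exact (hG₁s'.comp hc fun p hp => hp).snd
  · show (G₁.symm (p₀, 0)).2 = w₀
    rw [← hΘ₀, G₁.left_inv hmem]
  · intro p hp
    have h1 : G₁ (G₁.symm (p, 0)) = (p, 0) := G₁.right_inv hp
    rw [hG₁Θ] at h1
    have h1a : (G₁.symm (p, 0)).1 = p := congrArg Prod.fst h1
    have h1b : fibreGrad f (G₁.symm (p, 0)) = 0 := congrArg Prod.snd h1
    rw [show ((p, (G₁.symm (p, 0)).2) : P × 𝔼 k) = G₁.symm (p, 0) from Prod.ext h1a.symm rfl]
    exact h1b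

/-! ### Fibrewise Morse coordinates -/

/-- **The fibrewise Morse lemma over a parameter space `P`.**  Let `g : P × ℝᵏ → ℝ` be `C^∞`
with `g(p, 0) = 0` and `∂ᵤ g(p, 0) = 0` for all `p`, and nondegenerate fibre Hessian at
`(p₀, 0)`, of negative index of inertia `σ`.  Then on an open `W ∋ (p₀, 0)` there is a `C^∞`
map `y : W → ℝᵏ` with `y(p, 0) = 0`, `∂ᵤ y(p₀, 0) = Λ` invertible, and
`g(p, u) = -(y₀² + ⋯ + y_{σ-1}²) + (y_σ² + ⋯ + y_{k-1}²)` on `W`.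
[cite: HirschDT1976, Ch. 6 §1, Thm. 1.1 (proof, pp. 145–146)] -/
theorem exists_fibrewiseMorseCoords {g : P × 𝔼 k → ℝ} (hg : ContDiff ℝ ∞ g)
    (h0 : ∀ p, g (p, 0) = 0) (h1 : ∀ (p : P) (a : 𝔼 k), fderiv ℝ g (p, 0) ((0 : P), a) = 0)
    {p₀ : P} (hH : ∀ a : 𝔼 k, (∀ b, fibreHessian g (p₀, 0) a b = 0) → a = 0) :
    ∃ (W : Set (P × 𝔼 k)) (y : P × 𝔼 k → 𝔼 k) (Λ : 𝔼 k ≃L[ℝ] 𝔼 k),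
      IsOpen W ∧ ((p₀, (0 : 𝔼 k)) : P × 𝔼 k) ∈ W ∧ ContDiffOn ℝ ∞ y W ∧
      (∀ p : P, ((p, (0 : 𝔼 k)) : P × 𝔼 k) ∈ W → y (p, 0) = 0) ∧
      HasFDerivAt (fun u : 𝔼 k => y (p₀, u)) (Λ : 𝔼 k →L[ℝ] 𝔼 k) 0 ∧
      ∀ q ∈ W, g q =
        - ∑ i ∈ Finset.univ.filter (fun i : Fin k =>
              i.val < sigNeg ((fibreHessian g (p₀, 0)).toBilinForm).toQuadraticMap), (y q i) ^ 2
        + ∑ i ∈ Finset.univ.filter (fun i : Fin k =>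
              sigNeg ((fibreHessian g (p₀, 0)).toBilinForm).toQuadraticMap ≤ i.val),
            (y q i) ^ 2 := by
  have h2 : (2 : WithTop ℕ∞) ≤ ∞ := WithTop.coe_le_coe.2 le_top
  set B : P × 𝔼 k → (𝔼 k →L[ℝ] 𝔼 k →L[ℝ] ℝ) :=
    Literature.Analysis.Calculus.fibreHadamardSnd g with hB
  have hBs : ContDiff ℝ ∞ B := Literature.Analysis.Calculus.contDiff_fibreHadamardSnd hg
  have hBsymm : ∀ (q : P × 𝔼 k) (u v : 𝔼 k), B q u v = B q v u := fun q u v => by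
    obtain ⟨p, w⟩ := q
    exact Literature.Analysis.Calculus.fibreHadamardSnd_symm hg h2 p w u v
  have hgB : ∀ q : P × 𝔼 k, g q = B q q.2 q.2 := fun q => by
    obtain ⟨p, u⟩ := q
    exact Literature.Analysis.Calculus.eq_fibreHadamardSnd_of_isCritical hg h2 (h0 p) (h1 p) u
  set B₀ : 𝔼 k →L[ℝ] 𝔼 k →L[ℝ] ℝ := B (p₀, 0) with hB₀
  have hB₀H : B₀ = (2⁻¹ : ℝ) • fibreHessian g (p₀, 0) := by
    ext a b
    rw [hB₀, hB, Literature.Analysis.Calculus.fibreHadamardSnd_apply_zero]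
    simp
  have hB₀symm : ∀ u v, B₀ u v = B₀ v u := hBsymm _
  have hB₀nd : ∀ u, (∀ v, B₀ u v = 0) → u = 0 := by
    intro u hu
    refine hH u fun v => ?_
    have := hu v
    rw [hB₀H] at this
    simpa using this
  obtain ⟨N, Pm, hNo, hB₀N, hPs, hPB₀, hPeq⟩ := exists_contDiffOn_bilinearComp_eq B₀ hB₀symm hB₀nd
  obtain ⟨Λ, hΛ⟩ := exists_continuousLinearEquiv_eq_sum_sq B₀ hB₀symm hB₀nd (n := k)
    finrank_euclideanSpace_fin
  have hσ : sigNeg ((B₀.toBilinForm).toQuadraticMap) =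
      sigNeg (((fibreHessian g (p₀, 0)).toBilinForm).toQuadraticMap) := by
    rw [hB₀H, toQuadraticMap_toBilinForm_smul, sigNeg_smul_of_pos _ (by norm_num)]
  set W : Set (P × 𝔼 k) := B ⁻¹' N with hW
  have hWo : IsOpen W := hNo.preimage hBs.continuous
  have hW₀ : ((p₀, (0 : 𝔼 k)) : P × 𝔼 k) ∈ W := hB₀N
  set θ : P × 𝔼 k → 𝔼 k := fun q => Pm (B q) q.2 with hθ
  set y : P × 𝔼 k → 𝔼 k := fun q => Λ (θ q) with hy
  have hPB : ContDiffOn ℝ ∞ (fun q => Pm (B q)) W := hPs.comp hBs.contDiffOn fun q hq => hq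
  have hθs : ContDiffOn ℝ ∞ θ W := hPB.clm_apply contDiffOn_snd
  have hys : ContDiffOn ℝ ∞ y W := Λ.contDiff.comp_contDiffOn hθs
  refine ⟨W, y, Λ, hWo, hW₀, hys, ?_, ?_, ?_⟩
  · intro p _
    simp [hy, hθ]
  · have hc : DifferentiableAt ℝ (fun u : 𝔼 k => Pm (B (p₀, u))) 0 := by
      have h : ContDiffAt ℝ ∞ (fun u : 𝔼 k => Pm (B (p₀, u))) 0 :=
        (hPB.contDiffAt (hWo.mem_nhds hW₀)).comp 0 (contDiff_prodMk_right p₀).contDiffAt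
      exact h.differentiableAt (by simp)
    have hθd : HasFDerivAt (fun u : 𝔼 k => θ (p₀, u)) (ContinuousLinearMap.id ℝ (𝔼 k)) 0 := by
      have h := hc.hasFDerivAt.clm_apply (hasFDerivAt_id (0 : 𝔼 k))
      refine h.congr_fderiv ?_
      ext v
      simp [← hB₀, hPB₀]
    have hyd := (Λ : 𝔼 k →L[ℝ] 𝔼 k).hasFDerivAt.comp (0 : 𝔼 k) hθd
    exact hyd.congr_fderiv (by ext v; simp)
  · intro q hq
    have hqeq : g q = B₀ (θ q) (θ q) := by
      rw [hgB q]
      exact (hPeq (B q) hq (hBsymm q) q.2 q.2).symm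
    rw [hqeq, hΛ (θ q), ← hσ]

end Splitting

end Literature.Topology.FourManifolds
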